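import Literature.Probability.RandomPlanarGeometry.ConformalWelding
import Literature.Topology.PlaneTopology.ArcLoops

/-!
# Arcs of a four-marked Jordan domain and the open chord
# (route `SAWWeldingIdentification`, helper for item `WeldingSetup`, stmt-CriticalPhenomena-4504)

Fix a conformal rectangle `Q = (Ω; a, c_L, b, c_R)` (`a = Q.pt 0`, `c_L = Q.pt 1`, `b = Q.pt 2`,
`c_R = Q.pt 3`) and a simple chord `γ` of `(Ω; a, b)` (`MarkedDomain.IsSimpleChord`, the clause
inlined by the route). Elementary plane topology used by the bank analysis of the route items
`WeldingSetup` / `WeldingRigidity` / `WeldingContinuity`: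

* the two open boundary arcs `A_L = boundary (m₀, m₂) ∋ c_L` and `A_R = boundary (m₂, m₀ + 1) ∋ c_R`:
  they are disjoint, miss `a, b`, tile `∂Ω ∖ {a, b}` (`frontier_diff_eq_arcs`) and are separated
  (`disjoint_closure_arc_left_arc_right`, `disjoint_arc_left_closure_arc_right`);
* the open chord `γ° = γ ∖ {a, b}`: non-empty, inside `Ω`, separated from both arcs;
* `exists_param_of_isSimpleChord` — a real parametrisation of the chord, and `isCrosscut_range` —
  the chord is a cross-cut of `Ω` from `a` to `b` in the sense of Newman (`Crosscut.lean`).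

No new definitions. References: M. H. A. Newman, *Elements of the topology of plane sets of
points* (1939), Ch. V §11; Ch. Pommerenke, *Boundary Behaviour of Conformal Maps* (1992), §2.2.
-/

noncomputable section

namespace Summit.CriticalPhenomena.SAWScalingLimit.Theorems

open Set Filter Topology Complex Metric Function
open Literature.Probability.RandomPlanarGeometry Literature.Topology.PlaneTopology

variable {Q : ConformalRectangle} {γ : CurveClass ℂ}

/-! ### Marks and arcs of the four-marked domain -/

/-- `m₀ < m₂`. [folklore] -/
theorem mark_zero_lt_mark_two (Q : ConformalRectangle) : Q.mark 0 < Q.mark 2 :=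
  Q.strictMono_mark (show (0 : Fin 4) < 2 by decide)

/-- `m₂ < m₀ + 1`. [folklore] -/
theorem mark_two_lt_mark_zero_add_one (Q : ConformalRectangle) : Q.mark 2 < Q.mark 0 + 1 := by
  linarith [(Q.mark_mem 2).2, (Q.mark_mem 0).1]

/-- `m₁ ∈ (m₀, m₂)`. [folklore] -/
theorem mark_one_mem_Ioo (Q : ConformalRectangle) : Q.mark 1 ∈ Ioo (Q.mark 0) (Q.mark 2) :=
  ⟨Q.strictMono_mark (show (0 : Fin 4) < 1 by decide), Q.strictMono_mark (show (1 : Fin 4) < 2 by decide)⟩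

/-- `m₃ ∈ (m₂, m₀ + 1)`. [folklore] -/
theorem mark_three_mem_Ioo (Q : ConformalRectangle) : Q.mark 3 ∈ Ioo (Q.mark 2) (Q.mark 0 + 1) :=
  ⟨Q.strictMono_mark (show (2 : Fin 4) < 3 by decide), by linarith [(Q.mark_mem 3).2, (Q.mark_mem 0).1]⟩

/-- `a = boundary (m₀ + 1)` (periodicity). [folklore] -/
theorem boundary_mark_zero_add_one (Q : ConformalRectangle) : Q.boundary (Q.mark 0 + 1) = Q.pt 0 :=
  Q.periodic_boundary _

/-- A boundary point with parameter in `(m₀, m₂)` is neither `a` nor `b`. [folklore] -/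
theorem boundary_ne_of_mem_Ioo_left {t : ℝ} (ht : t ∈ Ioo (Q.mark 0) (Q.mark 2)) :
    Q.boundary t ≠ Q.pt 0 ∧ Q.boundary t ≠ Q.pt 2 := by
  have hinj := Q.injOn_boundary_Ico (Q.mark 0)
  have h20 := mark_two_lt_mark_zero_add_one Q
  have htI : t ∈ Ico (Q.mark 0) (Q.mark 0 + 1) := ⟨ht.1.le, by linarith [ht.2]⟩
  refine ⟨fun h => ?_, fun h => ?_⟩
  · have := hinj htI ⟨le_rfl, by linarith⟩ h
    linarith [ht.1]
  · have := hinj htI ⟨(mark_zero_lt_mark_two Q).le, h20⟩ h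
    linarith [ht.2]

/-- A boundary point with parameter in `(m₂, m₀ + 1)` is neither `a` nor `b`. [folklore] -/
theorem boundary_ne_of_mem_Ioo_right {t : ℝ} (ht : t ∈ Ioo (Q.mark 2) (Q.mark 0 + 1)) :
    Q.boundary t ≠ Q.pt 0 ∧ Q.boundary t ≠ Q.pt 2 := by
  have hinj := Q.injOn_boundary_Ico (Q.mark 0)
  have h02 := mark_zero_lt_mark_two Q
  have htI : t ∈ Ico (Q.mark 0) (Q.mark 0 + 1) := ⟨by linarith [ht.1], ht.2⟩
  refine ⟨fun h => ?_, fun h => ?_⟩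
  · have := hinj htI ⟨le_rfl, by linarith⟩ h
    linarith [ht.1]
  · have := hinj htI ⟨h02.le, mark_two_lt_mark_zero_add_one Q⟩ h
    linarith [ht.1]

/-- The two open arcs `boundary (m₀, m₂)` and `boundary (m₂, m₀ + 1)` are disjoint. [folklore] -/
theorem disjoint_arcs (Q : ConformalRectangle) :
    Disjoint (Q.boundary '' Ioo (Q.mark 0) (Q.mark 2)) (Q.boundary '' Ioo (Q.mark 2) (Q.mark 0 + 1)) := by
  rw [Set.disjoint_left]
  rintro _ ⟨t, ht, rfl⟩ ⟨t', ht', heq⟩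
  have hinj := Q.injOn_boundary_Ico (Q.mark 0)
  have := hinj ⟨by linarith [ht'.1, mark_zero_lt_mark_two Q], ht'.2⟩
    ⟨ht.1.le, by linarith [ht.2, mark_two_lt_mark_zero_add_one Q]⟩ heq
  linarith [ht.2, ht'.1]

/-- The closed arc is the open arc plus its two end-points (`a`, `b`). [folklore] -/
theorem image_Icc_left_eq (Q : ConformalRectangle) :
    Q.boundary '' Icc (Q.mark 0) (Q.mark 2) = Q.boundary '' Ioo (Q.mark 0) (Q.mark 2) ∪ {Q.pt 0, Q.pt 2} := by
  rw [← Ioo_union_both (mark_zero_lt_mark_two Q).le, image_union]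
  congr 1
  rw [image_pair]
  rfl

/-- The closed arc is the open arc plus its two end-points (`b`, `a`). [folklore] -/
theorem image_Icc_right_eq (Q : ConformalRectangle) :
    Q.boundary '' Icc (Q.mark 2) (Q.mark 0 + 1) =
      Q.boundary '' Ioo (Q.mark 2) (Q.mark 0 + 1) ∪ {Q.pt 0, Q.pt 2} := by
  rw [← Ioo_union_both (mark_two_lt_mark_zero_add_one Q).le, image_union]
  congr 1
  rw [image_pair, boundary_mark_zero_add_one, pair_comm]
  rfl

/-- `c_L` lies on the open arc `boundary (m₀, m₂)`. [folklore] -/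
theorem pt_one_mem_arc (Q : ConformalRectangle) : Q.pt 1 ∈ Q.boundary '' Ioo (Q.mark 0) (Q.mark 2) :=
  ⟨Q.mark 1, mark_one_mem_Ioo Q, rfl⟩

/-- `c_R` lies on the open arc `boundary (m₂, m₀ + 1)`. [folklore] -/
theorem pt_three_mem_arc (Q : ConformalRectangle) :
    Q.pt 3 ∈ Q.boundary '' Ioo (Q.mark 2) (Q.mark 0 + 1) :=
  ⟨Q.mark 3, mark_three_mem_Ioo Q, rfl⟩

/-- The frontier of `Ω` minus `{a, b}` is the disjoint union of the two open arcs. [folklore] -/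
theorem frontier_diff_eq_arcs (Q : ConformalRectangle) :
    Q.boundary '' Ioo (Q.mark 0) (Q.mark 2) ∪ Q.boundary '' Ioo (Q.mark 2) (Q.mark 0 + 1) =
      frontier Q.carrier \ {Q.pt 0, Q.pt 2} := by
  rw [Q.frontier_eq_union_image_boundary (Q.mark 0) (Q.mark 2), image_Icc_left_eq,
    image_Icc_right_eq]
  ext z
  simp only [mem_union, Set.mem_sdiff, mem_insert_iff, mem_singleton_iff]
  constructor
  · rintro (⟨t, ht, rfl⟩ | ⟨t, ht, rfl⟩)
    · exact ⟨Or.inl (Or.inl ⟨t, ht, rfl⟩), not_or.2 (boundary_ne_of_mem_Ioo_left ht)⟩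
    · exact ⟨Or.inr (Or.inl ⟨t, ht, rfl⟩), not_or.2 (boundary_ne_of_mem_Ioo_right ht)⟩
  · rintro ⟨(h | h) | (h | h), hne⟩
    · exact Or.inl h
    · exact absurd h hne
    · exact Or.inr h
    · exact absurd h hne

/-- The closure of the open arc `boundary (m₀, m₂)` lies in the closed arc. [folklore] -/
theorem closure_arc_left_subset (Q : ConformalRectangle) :
    closure (Q.boundary '' Ioo (Q.mark 0) (Q.mark 2)) ⊆ Q.boundary '' Icc (Q.mark 0) (Q.mark 2) :=
  closure_minimal (image_mono Ioo_subset_Icc_self)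
    ((isCompact_Icc.image Q.continuous_boundary).isClosed)

/-- The closure of the open arc `boundary (m₂, m₀ + 1)` lies in the closed arc. [folklore] -/
theorem closure_arc_right_subset (Q : ConformalRectangle) :
    closure (Q.boundary '' Ioo (Q.mark 2) (Q.mark 0 + 1)) ⊆ Q.boundary '' Icc (Q.mark 2) (Q.mark 0 + 1) :=
  closure_minimal (image_mono Ioo_subset_Icc_self)
    ((isCompact_Icc.image Q.continuous_boundary).isClosed)

/-- Separation of the two open arcs: `closure A_L ∩ A_R = ∅`. [folklore] -/
theorem disjoint_closure_arc_left_arc_right (Q : ConformalRectangle) :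
    Disjoint (closure (Q.boundary '' Ioo (Q.mark 0) (Q.mark 2)))
      (Q.boundary '' Ioo (Q.mark 2) (Q.mark 0 + 1)) := by
  refine Set.disjoint_left.2 fun z hz hz' => ?_
  have hz1 := closure_arc_left_subset Q hz
  rw [image_Icc_left_eq] at hz1
  rcases hz1 with h | h
  · exact Set.disjoint_left.1 (disjoint_arcs Q) h hz'
  · obtain ⟨t, ht, rfl⟩ := hz'
    rcases h with h | h
    · exact (boundary_ne_of_mem_Ioo_right ht).1 h
    · exact (boundary_ne_of_mem_Ioo_right ht).2 h

/-- Separation of the two open arcs: `A_L ∩ closure A_R = ∅`. [folklore] -/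
theorem disjoint_arc_left_closure_arc_right (Q : ConformalRectangle) :
    Disjoint (Q.boundary '' Ioo (Q.mark 0) (Q.mark 2))
      (closure (Q.boundary '' Ioo (Q.mark 2) (Q.mark 0 + 1))) := by
  refine Set.disjoint_left.2 fun z hz hz' => ?_
  have hz1 := closure_arc_right_subset Q hz'
  rw [image_Icc_right_eq] at hz1
  rcases hz1 with h | h
  · exact Set.disjoint_left.1 (disjoint_arcs Q) hz h
  · obtain ⟨t, ht, rfl⟩ := hz
    rcases h with h | h
    · exact (boundary_ne_of_mem_Ioo_left ht).1 h
    · exact (boundary_ne_of_mem_Ioo_left ht).2 h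

/-! ### The chord -/

section Chord

variable (hγ : (Q.chord 0 2 (by decide)).IsSimpleChord γ)
include hγ

/-- **A parametrisation of a simple chord**: a continuous `p : ℝ → ℂ`, injective on `[0, 1]`,
with `p '' [0, 1] = γ`, `p 0 = a`, `p 1 = b` (from an injective representative of the simple
class `γ`, extended constantly outside `[0, 1]`). [folklore] -/
theorem exists_param_of_isSimpleChord :
    ∃ p : ℝ → ℂ, Continuous p ∧ InjOn p (Icc 0 1) ∧ p '' Icc 0 1 = γ.range ∧
      p 0 = Q.pt 0 ∧ p 1 = Q.pt 2 := by
  obtain ⟨γ₀, hinj, hγ₀⟩ := hγ.1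
  have hs : γ.source = Q.pt 0 := hγ.2.1
  have ht : γ.target = Q.pt 2 := hγ.2.2.1
  subst hγ₀
  refine ⟨fun t => γ₀ (projIcc 0 1 zero_le_one t), γ₀.continuous.comp continuous_projIcc,
    ?_, ?_, ?_, ?_⟩
  · intro s hs' t ht' h
    have h1 : projIcc 0 1 zero_le_one s = projIcc 0 1 zero_le_one t := hinj h
    rw [projIcc_of_mem _ hs', projIcc_of_mem _ ht'] at h1
    exact congrArg Subtype.val h1
  · ext z
    constructor
    · rintro ⟨t, -, rfl⟩
      exact ⟨_, rfl⟩
    · rintro ⟨u, rfl⟩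
      exact ⟨u, u.2, by simp [projIcc_of_mem _ u.2]⟩
  · simpa [Curve.source_def, projIcc_of_mem _ (left_mem_Icc.2 (zero_le_one' ℝ))] using hs
  · simpa [Curve.target_def, projIcc_of_mem _ (right_mem_Icc.2 (zero_le_one' ℝ))] using ht

/-- `a ∈ γ`. [folklore] -/
theorem pt_zero_mem_range : Q.pt 0 ∈ γ.range := hγ.2.1 ▸ γ.source_mem_range

/-- `b ∈ γ`. [folklore] -/
theorem pt_two_mem_range : Q.pt 2 ∈ γ.range := hγ.2.2.1 ▸ γ.target_mem_range

/-- The chord is `γ° ∪ {a, b}`. [folklore] -/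
theorem range_eq_diff_union : γ.range = (γ.range \ {Q.pt 0, Q.pt 2}) ∪ {Q.pt 0, Q.pt 2} := by
  rw [sdiff_union_self, eq_comm, union_eq_left]
  rintro z (rfl | rfl)
  · exact pt_zero_mem_range hγ
  · exact pt_two_mem_range hγ

/-- The open chord `γ° = γ ∖ {a, b}` lies in the open domain. [folklore] -/
theorem range_diff_subset_carrier : γ.range \ {Q.pt 0, Q.pt 2} ⊆ Q.carrier :=
  hγ.range_diff_subset

/-- The open chord misses the frontier of `Ω`. [folklore] -/
theorem disjoint_range_diff_frontier : Disjoint (γ.range \ {Q.pt 0, Q.pt 2}) (frontier Q.carrier) :=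
  Set.disjoint_left.2 fun z hz hzf => by
    have : z ∈ Q.carrier ∩ frontier Q.carrier := ⟨range_diff_subset_carrier hγ hz, hzf⟩
    rw [Q.isOpen.inter_frontier_eq] at this
    exact this

/-- The open chord is non-empty (the chord is a simple arc between two distinct points).
[folklore] -/
theorem range_diff_nonempty : (γ.range \ {Q.pt 0, Q.pt 2}).Nonempty := by
  obtain ⟨p, -, hpinj, hprange, hp0, hp1⟩ := exists_param_of_isSimpleChord hγ
  refine ⟨p (1 / 2), ?_, ?_⟩
  · rw [← hprange]
    exact ⟨1 / 2, by norm_num, rfl⟩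
  · have hh : (1 / 2 : ℝ) ∈ Icc (0 : ℝ) 1 := by norm_num
    rintro (h | h)
    · have := hpinj hh (left_mem_Icc.2 zero_le_one) (h.trans hp0.symm)
      norm_num at this
    · have := hpinj hh (right_mem_Icc.2 zero_le_one) (h.trans hp1.symm)
      norm_num at this

/-- The chord meets the open arcs nowhere: `γ ∩ A_L = ∅`. [folklore] -/
theorem disjoint_range_arc_left : Disjoint γ.range (Q.boundary '' Ioo (Q.mark 0) (Q.mark 2)) := by
  refine Set.disjoint_left.2 fun z hz hz' => ?_
  obtain ⟨t, ht, rfl⟩ := hz'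
  rcases hγ.range_inter_frontier_subset ⟨hz, Q.boundary_mem_frontier t⟩ with h | h
  · exact (boundary_ne_of_mem_Ioo_left ht).1 h
  · exact (boundary_ne_of_mem_Ioo_left ht).2 h

/-- The chord meets the open arcs nowhere: `γ ∩ A_R = ∅`. [folklore] -/
theorem disjoint_range_arc_right :
    Disjoint γ.range (Q.boundary '' Ioo (Q.mark 2) (Q.mark 0 + 1)) := by
  refine Set.disjoint_left.2 fun z hz hz' => ?_
  obtain ⟨t, ht, rfl⟩ := hz'
  rcases hγ.range_inter_frontier_subset ⟨hz, Q.boundary_mem_frontier t⟩ with h | h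
  · exact (boundary_ne_of_mem_Ioo_right ht).1 h
  · exact (boundary_ne_of_mem_Ioo_right ht).2 h

/-- `closure A_L ∩ γ° = ∅`. [folklore] -/
theorem disjoint_closure_arc_left_range_diff :
    Disjoint (closure (Q.boundary '' Ioo (Q.mark 0) (Q.mark 2))) (γ.range \ {Q.pt 0, Q.pt 2}) :=
  Set.disjoint_left.2 fun z hz hz' =>
    Set.disjoint_left.1 (disjoint_range_diff_frontier hγ) hz' (by
      obtain ⟨t, -, rfl⟩ := closure_arc_left_subset Q hz
      exact Q.boundary_mem_frontier t)

/-- `A_L ∩ closure γ° = ∅`. [folklore] -/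
theorem disjoint_arc_left_closure_range_diff :
    Disjoint (Q.boundary '' Ioo (Q.mark 0) (Q.mark 2)) (closure (γ.range \ {Q.pt 0, Q.pt 2})) :=
  Set.disjoint_left.2 fun _ hz hz' =>
    Set.disjoint_left.1 (disjoint_range_arc_left hγ)
      (closure_minimal sdiff_subset γ.isCompact_range.isClosed hz') hz

/-- `closure A_R ∩ γ° = ∅`. [folklore] -/
theorem disjoint_closure_arc_right_range_diff :
    Disjoint (closure (Q.boundary '' Ioo (Q.mark 2) (Q.mark 0 + 1))) (γ.range \ {Q.pt 0, Q.pt 2}) :=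
  Set.disjoint_left.2 fun z hz hz' =>
    Set.disjoint_left.1 (disjoint_range_diff_frontier hγ) hz' (by
      obtain ⟨t, -, rfl⟩ := closure_arc_right_subset Q hz
      exact Q.boundary_mem_frontier t)

/-- `A_R ∩ closure γ° = ∅`. [folklore] -/
theorem disjoint_arc_right_closure_range_diff :
    Disjoint (Q.boundary '' Ioo (Q.mark 2) (Q.mark 0 + 1)) (closure (γ.range \ {Q.pt 0, Q.pt 2})) :=
  Set.disjoint_left.2 fun _ hz hz' =>
    Set.disjoint_left.1 (disjoint_range_arc_right hγ)
      (closure_minimal sdiff_subset γ.isCompact_range.isClosed hz') hz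

/-- **The chord is a cross-cut** of `Ω` from `a = boundary m₀` to `b = boundary m₂`. [folklore] -/
theorem isCrosscut_range :
    Q.toJordanDomain.IsCrosscut γ.range (Q.boundary (Q.mark 0)) (Q.boundary (Q.mark 2)) := by
  obtain ⟨p, hp, hpinj, hprange, hp0, hp1⟩ := exists_param_of_isSimpleChord hγ
  refine ⟨⟨p, hp.continuousOn, hpinj, hprange, hp0, hp1⟩, Q.pt_mem_frontier 0, Q.pt_mem_frontier 2,
    fun h => absurd (Q.pt_injective h) (by decide), hγ.range_diff_subset⟩


end Chord

end Summit.CriticalPhenomena.SAWScalingLimit.Theorems
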